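import Literature.Barriers.FinalStateConjecture.KleinGordonSuperradiantInstabilityProofs
import Literature.Geometry.Lorentzian.KerrSchildDivergence
import Mathlib.Analysis.InnerProductSpace.Laplacian
import HarnessLib

/-!
# Barrier catalogue `FinalStateConjecture`: Shlapentokh-Rothman's superradiant instability —
# the reduced Kerr wave operator in terms of the Kerr–Schild structure

`KleinGordonSuperradiantInstabilityProofs.lean` reduces the barrier fact
`KleinGordonSuperradiantInstability` (SR, CMP 329 (2014), Thm. 1.1) to the named fact
`ShlapentokhRothman2014_unstableModeProfile`: a profile `Φ` on the Kerr–Schild leaf solving the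
reduced (time-Fourier-transformed) equation `P_ω Φ = μ² Φ`, `P_ω = reducedWaveOp M a ω`, the
divergence form `Σ_μ ∂_μ(g^{μν} ∂_ν ·)` of `□_g` in the unimodular stationary ingoing Kerr–Schild
chart with `∂_{t_KS} ↦ −iω`. This file computes `P_ω` explicitly from the Kerr–Schild structure
`g^{μν} = η^{μν} − 2H ℓ^μ ℓ^ν` (`Kerr.inverseMetric_apply`), the divergence
`Σ_μ ∂_μ g^{μν} = −(2M/Σ) ℓ^ν` (`Kerr.divInverseMetric_eq`) and stationarity:

`P_ω Φ = ω²(1 + 2H) Φ − 4iωH ∂_ℓΦ − (2iωM/Σ) Φ − (2M/Σ) ∂_ℓΦ − 2H D²Φ(ℓ⃗, ℓ⃗) + ΔΦ`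

(`reducedWaveOp_eq`; `H = Mr/Σ`, `ℓ⃗` the spatial Kerr–Schild null vector, `∂_ℓ = DΦ(ℓ⃗)`, `Δ` the
flat Laplacian of the leaf = Mathlib's `Laplacian.laplacian`), i.e.
`Σ P_ω Φ = ω²(Σ + 2Mr)Φ − 4iωMr ∂_ℓΦ − 2iωM Φ − 2M ∂_ℓΦ − 2Mr D²Φ(ℓ⃗, ℓ⃗) + Σ ΔΦ` — the
Cartesian form of the stationary Kerr wave operator which, read in Kerr's ingoing spheroidal
coordinates (`KerrStarCoord.lean`: `ℓ⃗ = ∂_r`, and the flat Laplacian there), becomes the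
separable operator of SR §2 (sibling file `…Separation.lean`). Also: `P_ω Φ` is continuous on the
slice for `Φ ∈ C^∞` (`continuousOn_reducedWaveOp`), used to pass the separated equation to the axis.

## References
* Y. Shlapentokh-Rothman, CMP 329 (2014) 859–891, §1.2.1 (Kerr-star form of `g`), §2 (mode
  solutions, (2.1)–(2.2)) (key `ShlapentokhRothman2014KleinGordon`).
* R. P. Kerr, A. Schild (1965), §2 (`g^{μν} = η^{μν} − 2Hℓ^μℓ^ν`, `det g = −1`) (key `KerrSchild1965`).
* M. Visser, arXiv:0706.0622, (33)–(35) and §4 (key `arXiv07060622`).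
-/

noncomputable section

open Set Filter Topology Laplacian
open scoped ContDiff

namespace Literature.Barriers.FinalStateConjecture

open Literature.Geometry.Lorentzian

/-! ### Bookkeeping on the leaf: basis vectors, the components `g^{μν}(0, ·)` and their divergence -/

/-- `(0, e_j) = ∂_{j+1}`: the slice embedding maps the standard basis of `E3` to the spatial
coordinate vectors of `E4`. [folklore] -/
theorem spaceEmbed_single (j : Fin 3) :
    E4.spaceEmbed (EuclideanSpace.single j (1 : ℝ)) = E4.basisVector j.succ := by
  rw [E4.spaceEmbed_apply]
  ext i
  refine Fin.cases ?_ (fun k ↦ ?_) i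
  · simp [E4.basisVector, Fin.succ_ne_zero]
  · rw [E4.ofTimeSpace_apply_succ]
    simp [E4.basisVector, Fin.succ_inj]

/-- `(ℓ♯)^{i+1} = ℓ⃗_i`: the spatial components of the null vector. [cite: arXiv07060622, (34)] -/
theorem nullVector_apply_succ (a : ℝ) (x : E4) (i : Fin 3) :
    Kerr.nullVector a x i.succ = Kerr.nullSpatial a x i := by
  rw [Kerr.nullSpatial, E4.spatial_apply]

/-- Expansion of a vector of `E3` in the standard basis. [folklore] -/
theorem E3.eq_sum_single (v : E3) : v = ∑ i, v i • EuclideanSpace.single i (1 : ℝ) := by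
  conv_lhs => rw [← (EuclideanSpace.basisFun (Fin 3) ℝ).sum_repr v]
  simp [EuclideanSpace.basisFun_apply]

/-- **Derivative of the components `g^{μν}(0, y)` along the leaf**: the real derivative of
`y ↦ g^{μν}(0, y)` (as a complex number) is `v ↦ ∂g^{μν}(0,y)(0, v)` (chain rule with the affine
slice map), wherever `r > 0`. [cite: KerrSchild1965, §2] -/
theorem hasFDerivAt_inverseMetric_leaf (M a : ℝ) {y : E3}
    (hr : 0 < Kerr.radius a (E4.ofTimeSpace 0 y)) (μ ν : Fin 4) :
    HasFDerivAt (fun y : E3 ↦ (Kerr.inverseMetric M a (E4.ofTimeSpace 0 y) μ ν : ℂ))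
      (Complex.ofRealCLM.comp ((fderiv ℝ (fun x ↦ Kerr.inverseMetric M a x μ ν)
        (E4.ofTimeSpace 0 y)).comp E4.spaceEmbed)) y := by
  have h1 : HasFDerivAt (fun x ↦ Kerr.inverseMetric M a x μ ν)
      (fderiv ℝ (fun x ↦ Kerr.inverseMetric M a x μ ν) (E4.ofTimeSpace 0 y)) (E4.ofTimeSpace 0 y) :=
    ((Kerr.contDiffAt_inverseMetric M a hr μ ν (n := 1)).differentiableAt one_ne_zero).hasFDerivAt
  have h2 := h1.comp y (E4.hasFDerivAt_ofTimeSpace 0 y)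
  exact Complex.ofRealCLM.hasFDerivAt.comp y h2

/-- **The spatial divergence of `g^{μν}` on the leaf**: `Σ_j ∂_{j+1} g^{j+1,ν}(0, y) =
−(2M/Σ(y)) (ℓ♯)^ν` — the coordinate divergence `Σ_μ ∂_μ g^{μν} = −(2M/Σ)ℓ^ν`
(`Kerr.divInverseMetric_eq`) minus the vanishing time derivative (stationarity,
`Kerr.fderiv_inverseMetric_basisVector_zero`). [cite: KerrSchild1965, §2] -/
theorem sum_fderiv_inverseMetric_succ (M a : ℝ) {y : E3}
    (hr : 0 < Kerr.radius a (E4.ofTimeSpace 0 y)) (ν : Fin 4) :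
    ∑ j : Fin 3, fderiv ℝ (fun x ↦ Kerr.inverseMetric M a x j.succ ν) (E4.ofTimeSpace 0 y)
        (E4.basisVector j.succ) =
      -(2 * M / Kerr.blSigma a y) * Kerr.nullVector a (E4.ofTimeSpace 0 y) ν := by
  have h := Kerr.divInverseMetric_eq M a hr ν
  rw [Kerr.divInverseMetric, Fin.sum_univ_succ, Kerr.fderiv_inverseMetric_basisVector_zero M a hr,
    zero_add, E4.spatial_ofTimeSpace] at h
  exact h

/-- The flat Laplacian of the leaf is the sum of the second coordinate derivatives:
`ΔΦ(y) = Σ_j D²Φ(y)(e_j, e_j)` (Mathlib's Laplacian in the standard orthonormal basis). [folklore] -/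
theorem laplacian_eq_sum_E3 {F : Type*} [NormedAddCommGroup F] [NormedSpace ℝ F] (Φ : E3 → F)
    (y : E3) :
    Δ Φ y = ∑ j : Fin 3, fderiv ℝ (fderiv ℝ Φ) y (EuclideanSpace.single j (1 : ℝ))
      (EuclideanSpace.single j (1 : ℝ)) := by
  rw [InnerProductSpace.laplacian_eq_iteratedFDeriv_orthonormalBasis Φ (EuclideanSpace.basisFun (Fin 3) ℝ)]
  simp only [iteratedFDeriv_two_apply, Matrix.cons_val_zero, Matrix.cons_val_one,
    EuclideanSpace.basisFun_apply]

/-! ### The reduced wave operator from the Kerr–Schild structure -/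

/-- **The reduced Kerr wave operator in terms of `H`, `ℓ⃗` and the flat Laplacian.** For a profile
`Φ : E3 → ℂ` of class `C²` at a point `y` of the leaf with `r(0, y) > 0`,
`P_ω Φ(y) = ω²(1 + 2H)Φ − 4iωH DΦ(ℓ⃗) − (2iωM/Σ)Φ − (2M/Σ) DΦ(ℓ⃗) − 2H D²Φ(ℓ⃗, ℓ⃗) + ΔΦ`,
where `H = H(0, y)` (`Kerr.scalarH`, `= Mr/Σ`), `Σ = Kerr.blSigma a y`, `ℓ⃗ = Kerr.nullSpatial a (0, y)`
and `Δ` is the flat Laplacian of `E3`. Obtained from `P_ω = −iω G⁰ + Σ_j ∂_j G^{j+1}`,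
`G^μ = g^{μ0}(−iωΦ) + Σ_k g^{μ,k+1}∂_kΦ`, with `g^{μν} = η^{μν} − 2Hℓ^μℓ^ν`, `ℓ^0 = −1`, the product
rule and `Σ_j ∂_j g^{j+1,ν} = −(2M/Σ)ℓ^ν`; equivalently `□_g = g^{μν}∂_μ∂_ν − (2M/Σ)ℓ^ν∂_ν` with
`∂_t ↦ −iω` (Kerr–Schild 1965, §2; SR, CMP 329 (2014), §1.2.1 and §2 for the role of this operator).
[cite: KerrSchild1965, §2] -/
theorem reducedWaveOp_eq {M a : ℝ} (w : ℂ) {Φ : E3 → ℂ} {y : E3}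
    (hr : 0 < Kerr.radius a (E4.ofTimeSpace 0 y)) (hΦ : ContDiffAt ℝ 2 Φ y) :
    reducedWaveOp M a w Φ y =
      w ^ 2 * (1 + 2 * (Kerr.scalarH M a (E4.ofTimeSpace 0 y) : ℂ)) * Φ y
      - 4 * (Complex.I * w) * (Kerr.scalarH M a (E4.ofTimeSpace 0 y) : ℂ) *
          fderiv ℝ Φ y (Kerr.nullSpatial a (E4.ofTimeSpace 0 y))
      - 2 * (Complex.I * w) * ((M / Kerr.blSigma a y : ℝ) : ℂ) * Φ y
      - 2 * ((M / Kerr.blSigma a y : ℝ) : ℂ) * fderiv ℝ Φ y (Kerr.nullSpatial a (E4.ofTimeSpace 0 y))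
      - 2 * (Kerr.scalarH M a (E4.ofTimeSpace 0 y) : ℂ) *
          fderiv ℝ (fderiv ℝ Φ) y (Kerr.nullSpatial a (E4.ofTimeSpace 0 y))
            (Kerr.nullSpatial a (E4.ofTimeSpace 0 y))
      + Δ Φ y := by
  -- abbreviations
  set x₀ : E4 := E4.ofTimeSpace 0 y with hx₀
  set H : ℝ := Kerr.scalarH M a x₀ with hH
  set ℓ : E3 := Kerr.nullSpatial a x₀ with hℓ
  set g : Fin 4 → Fin 4 → ℝ := fun μ ν ↦ Kerr.inverseMetric M a x₀ μ ν with hg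
  set dg : Fin 3 → Fin 4 → ℝ := fun j ν ↦
    fderiv ℝ (fun x ↦ Kerr.inverseMetric M a x j.succ ν) x₀ (E4.basisVector j.succ) with hdg
  set D1 : E3 →L[ℝ] ℂ := fderiv ℝ Φ y with hD1
  set D2 : E3 →L[ℝ] E3 →L[ℝ] ℂ := fderiv ℝ (fderiv ℝ Φ) y with hD2
  have hΦ1 : DifferentiableAt ℝ Φ y := hΦ.differentiableAt (by norm_num)
  have hΦ2 : DifferentiableAt ℝ (fderiv ℝ Φ) y :=
    (hΦ.fderiv_right (m := 1) le_rfl).differentiableAt one_ne_zero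
  -- derivatives of the ingredients of the flux
  have hgd : ∀ μ ν, HasFDerivAt (fun y : E3 ↦ (Kerr.inverseMetric M a (E4.ofTimeSpace 0 y) μ ν : ℂ))
      (Complex.ofRealCLM.comp ((fderiv ℝ (fun x ↦ Kerr.inverseMetric M a x μ ν) x₀).comp
        E4.spaceEmbed)) y := fun μ ν ↦ hasFDerivAt_inverseMetric_leaf M a hr μ ν
  have hgd_apply : ∀ (j : Fin 3) (ν : Fin 4), (Complex.ofRealCLM.comp ((fderiv ℝ
      (fun x ↦ Kerr.inverseMetric M a x j.succ ν) x₀).comp E4.spaceEmbed)) (EuclideanSpace.single j (1 : ℝ)) = (dg j ν : ℂ) := by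
    intro j ν
    simp only [hdg, ContinuousLinearMap.comp_apply, spaceEmbed_single, Complex.ofRealCLM_apply]
  have hΦd : HasFDerivAt Φ D1 y := hΦ1.hasFDerivAt
  have hDd : ∀ k : Fin 3, HasFDerivAt (fun y ↦ fderiv ℝ Φ y (EuclideanSpace.single k (1 : ℝ))) (D2.flip (EuclideanSpace.single k (1 : ℝ))) y := by
    intro k
    have := hΦ2.hasFDerivAt.clm_apply (hasFDerivAt_const (EuclideanSpace.single k (1 : ℝ)) y)
    simpa using this
  -- the derivative of the spatial fluxes, evaluated on `e_j`
  have hflux : ∀ j : Fin 3, fderiv ℝ (modeFlux M a w Φ j.succ) y (EuclideanSpace.single j (1 : ℝ)) =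
      (dg j 0 : ℂ) * (-(Complex.I * w) * Φ y) + (g j.succ 0 : ℂ) * (-(Complex.I * w) * D1 (EuclideanSpace.single j (1 : ℝ))) +
      ∑ k : Fin 3, ((dg j k.succ : ℂ) * D1 (EuclideanSpace.single k (1 : ℝ)) + (g j.succ k.succ : ℂ) * D2 (EuclideanSpace.single j (1 : ℝ)) (EuclideanSpace.single k (1 : ℝ))) := by
    intro j
    have hA := (hgd j.succ 0).fun_mul (hΦd.const_mul (-(Complex.I * w)))
    have hB := HasFDerivAt.fun_sum fun k (_ : k ∈ Finset.univ) ↦ (hgd j.succ k.succ).fun_mul (hDd k)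
    have h := hA.fun_add hB
    rw [show modeFlux M a w Φ j.succ = fun y ↦
        (Kerr.inverseMetric M a (E4.ofTimeSpace 0 y) j.succ 0 : ℂ) * (-(Complex.I * w) * Φ y) +
        ∑ k : Fin 3, (Kerr.inverseMetric M a (E4.ofTimeSpace 0 y) j.succ k.succ : ℂ) *
          fderiv ℝ Φ y (EuclideanSpace.single k (1 : ℝ)) from rfl, h.fderiv]
    simp only [add_apply, smul_apply, smul_eq_mul, FunLike.coe_sum, Finset.sum_apply,
      ContinuousLinearMap.flip_apply, hgd_apply]
    rw [hg]
    congr 1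
    · ring
    · exact Finset.sum_congr rfl fun k _ ↦ by ring
  -- the divergence identities, cast to `ℂ`
  have hdiv : ∀ ν : Fin 4, ((dg 0 ν : ℂ) + dg 1 ν + dg 2 ν) =
      ((-(2 * M / Kerr.blSigma a y) * Kerr.nullVector a x₀ ν : ℝ) : ℂ) := by
    intro ν
    have h := sum_fderiv_inverseMetric_succ M a hr ν
    rw [Fin.sum_univ_three] at h
    rw [← h]
    push_cast [hdg]
    ring
  -- the values of the components
  have hg_apply : ∀ μ ν, g μ ν = (if μ = ν then (if μ = 0 then -1 else 1) else 0) -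
      2 * H * Kerr.nullVector a x₀ ν * Kerr.nullVector a x₀ μ := fun μ ν ↦
    Kerr.inverseMetric_apply M a x₀ μ ν
  have hV0 : Kerr.nullVector a x₀ 0 = -1 := Kerr.nullVector_apply_zero a x₀
  have hV : ∀ i : Fin 3, Kerr.nullVector a x₀ i.succ = ℓ i := fun i ↦ nullVector_apply_succ a x₀ i
  -- linear and bilinear expansions along `ℓ⃗`
  have hD1ℓ : D1 ℓ = ∑ k : Fin 3, (ℓ k : ℂ) * D1 (EuclideanSpace.single k (1 : ℝ)) := by
    conv_lhs => rw [E3.eq_sum_single ℓ]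
    simp [map_sum, map_smul, Complex.real_smul]
  have hD2ℓ : D2 ℓ ℓ = ∑ j : Fin 3, ∑ k : Fin 3,
      (ℓ j : ℂ) * ((ℓ k : ℂ) * D2 (EuclideanSpace.single k (1 : ℝ)) (EuclideanSpace.single j (1 : ℝ))) := by
    conv_lhs => rw [E3.eq_sum_single ℓ]
    simp only [map_sum, map_smul, FunLike.coe_sum, Finset.sum_apply, FunLike.coe_smul, Pi.smul_apply,
      Complex.real_smul, Finset.mul_sum]
  have hΔ : Δ Φ y = ∑ j : Fin 3, D2 (EuclideanSpace.single j (1 : ℝ)) (EuclideanSpace.single j (1 : ℝ)) := laplacian_eq_sum_E3 Φ y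
  have hMS : ((M / Kerr.blSigma a y : ℝ) : ℂ) = (M : ℂ) / (Kerr.blSigma a y : ℂ) := by push_cast; ring
  -- expand everything
  rw [reducedWaveOp, Fin.sum_univ_three]
  simp only [hflux]
  rw [show modeFlux M a w Φ 0 y = (g 0 0 : ℂ) * (-(Complex.I * w) * Φ y) +
      ∑ k : Fin 3, (g 0 k.succ : ℂ) * D1 (EuclideanSpace.single k (1 : ℝ)) from rfl]
  rw [hD1ℓ, hD2ℓ, hΔ]
  simp only [Fin.sum_univ_three, hg_apply, hV0, hV]
  simp only [Fin.succ_zero_eq_one, Fin.succ_one_eq_two, show (2 : Fin 3).succ = 3 from rfl,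
    Fin.isValue, ↓reduceIte, one_ne_zero, Fin.reduceEq]
  push_cast
  have h0 := hdiv 0
  have h1 := hdiv 1
  have h2 := hdiv 2
  have h3 := hdiv 3
  simp only [hV0, Fin.isValue, show (1 : Fin 4) = (0 : Fin 3).succ from rfl,
    show (2 : Fin 4) = (1 : Fin 3).succ from rfl, show (3 : Fin 4) = (2 : Fin 3).succ from rfl, hV]
    at h0 h1 h2 h3
  push_cast at h0 h1 h2 h3
  linear_combination (-(Complex.I * w) * Φ y) * h0 + D1 (EuclideanSpace.single 0 (1 : ℝ)) * h1 +
    D1 (EuclideanSpace.single 1 (1 : ℝ)) * h2 + D1 (EuclideanSpace.single 2 (1 : ℝ)) * h3 +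
    (-(2 * w ^ 2 * (H : ℂ) * Φ y) - w ^ 2 * Φ y) * Complex.I_sq

/-! ### Regularity: the reduced operator of a smooth profile is continuous on the slice -/

/-- The components `y ↦ g^{μν}(0, y)` (as complex numbers) are `C^∞` on every Kerr–Schild slice
(`r > 0` there). [cite: KerrSchild1965, §2] -/
theorem contDiffOn_inverseMetric_leaf (M a r₀ : ℝ) (μ ν : Fin 4) {n : WithTop ℕ∞} :
    ContDiffOn ℝ n (fun y : E3 ↦ (Kerr.inverseMetric M a (E4.ofTimeSpace 0 y) μ ν : ℂ))
      (Kerr.slice a r₀) := by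
  intro y hy
  have hr : 0 < Kerr.radius a (E4.ofTimeSpace 0 y) := Kerr.radius_pos_of_mem_region hy
  have h1 : ContDiffAt ℝ n (fun y : E3 ↦ Kerr.inverseMetric M a (E4.ofTimeSpace 0 y) μ ν) y :=
    (Kerr.contDiffAt_inverseMetric M a hr μ ν).comp y (E4.contDiff_ofTimeSpace 0).contDiffAt
  exact (Complex.ofRealCLM.contDiff.contDiffAt.comp y h1).contDiffWithinAt

/-- The flux profiles `G^μ` of a `C^∞` profile are `C^∞` on the slice. [folklore] -/
theorem contDiffOn_modeFlux {M a r₀ : ℝ} (w : ℂ) {Φ : E3 → ℂ}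
    (hΦ : ContDiffOn ℝ ∞ Φ (Kerr.slice a r₀)) (μ : Fin 4) :
    ContDiffOn ℝ ∞ (modeFlux M a w Φ μ) (Kerr.slice a r₀) := by
  have hS : IsOpen (Kerr.slice a r₀ : Set E3) := (Kerr.slice a r₀).isOpen
  have hD : ∀ k : Fin 3, ContDiffOn ℝ ∞ (fun y ↦ fderiv ℝ Φ y (EuclideanSpace.single k (1 : ℝ)))
      (Kerr.slice a r₀) := fun k ↦
    (hΦ.fderiv_of_isOpen hS le_rfl).clm_apply contDiffOn_const
  unfold modeFlux
  exact ((contDiffOn_inverseMetric_leaf M a r₀ μ 0).mul (contDiffOn_const.mul hΦ)).add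
    (ContDiffOn.sum fun k _ ↦ (contDiffOn_inverseMetric_leaf M a r₀ μ k.succ).mul (hD k))

/-- **The reduced operator of a smooth profile is continuous on the slice**: for `Φ ∈ C^∞` on
`Kerr.slice a r₀`, `y ↦ P_ω Φ(y)` is continuous there (the fluxes are `C^∞`, so their derivatives
are continuous on the open slice). Used to extend the separated equation `P_ω Φ = μ²Φ` from the
off-axis points to the axis by density. [folklore] -/
theorem continuousOn_reducedWaveOp {M a r₀ : ℝ} (w : ℂ) {Φ : E3 → ℂ}
    (hΦ : ContDiffOn ℝ ∞ Φ (Kerr.slice a r₀)) :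
    ContinuousOn (reducedWaveOp M a w Φ) (Kerr.slice a r₀) := by
  have hS : IsOpen (Kerr.slice a r₀ : Set E3) := (Kerr.slice a r₀).isOpen
  have hF := fun μ ↦ contDiffOn_modeFlux (M := M) w hΦ μ
  have hdF : ∀ j : Fin 3, ContinuousOn (fun y ↦ fderiv ℝ (modeFlux M a w Φ j.succ) y
      (EuclideanSpace.single j (1 : ℝ))) (Kerr.slice a r₀) := fun j ↦
    ((hF j.succ).continuousOn_fderiv_of_isOpen hS (by simp)).clm_apply continuousOn_const
  show ContinuousOn (fun y ↦ -(Complex.I * w) * modeFlux M a w Φ 0 y +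
    ∑ j : Fin 3, fderiv ℝ (modeFlux M a w Φ j.succ) y (EuclideanSpace.single j (1 : ℝ))) _
  exact (continuousOn_const.mul (hF 0).continuousOn).add (continuousOn_finsetSum _ fun j _ ↦ hdF j)

end Literature.Barriers.FinalStateConjecture

end
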